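import Mathlib
import HarnessLib
import Summits.Langlands.Langlands.Theses.NonParallelVoid
import Summits.Langlands.Langlands.Theorems.NonParallelVoidTensorSquareParallelStubEnormousResidualPackage
import Summits.Langlands.Langlands.Theorems.NonParallelVoidLocallyReducibleParallelStubQianPackageOfPrimeToPEnormous
import Summits.Langlands.Langlands.Theorems.NonParallelVoidLocallyReducibleParallelStubQianPackageOfPrimeToPScalar
import Literature.NumberTheory.GaloisRepresentations.ProjectiveType
import Literature.NumberTheory.GaloisRepresentations.TeichmullerLiftMonomial
import Literature.NumberTheory.GaloisRepresentations.SerreProp16PGL2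

/-!
# Stub `stub_qianPackage_of_primeToP` of line `potaut` for crux `LocallyReducibleParallel`
# (stmt-Langlands-17002): Qian's residual package (Qian 2023, Thm. 1.4 (iii)–(iv)) when the
# projective image of `ρ̄|_{Γ_{F(ζ_p)}}` has order prime to `p` — PROVED

Crux `stmt-Langlands-17002` = `Summit.Langlands.Langlands.Theses.NonParallelVoid.LocallyReducibleParallel`
(`F` imaginary quadratic, `ρ : Γ_F → GL₂(ℚ̄_p)` irreducible, a.e. unramified, de Rham with two
distinct labelled Hodge–Tate weights at every label and an invariant line at every `v ∣ p` ⟹ all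
labels have the same gap), line `potaut` (reshape r3), stub `stub_qianPackage_of_primeToP`
(registered signature, namespace `Summit.Langlands.Langlands.Cruxes.LocallyReducibleParallel.Potaut`).
On the good regime (`p ≥ 11` split, `ρ̄|_{Γ_{F(ζ_p)}}` absolutely irreducible) the line feeds Qian
2023 Thm. 1.4 through the landed sibling theorem `TensorSquareParallel.stub_ordinaryDihedralVoid`,
which consumes the six-conjunct "Qian residual package" — the conclusion of this stub — for
`τ = ρ̄ = ρ.residualRep` and `r = ρ̄|_{Γ_{F(ζ_p)}}` (`Γ_{F(ζ_p)} = absGaloisGroupAdjoinRootsOfUnity F p`):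

1. `ρ̄` is a residual representation of `ρ` — tree `isResidualRepOf_residualRep_fin_two`;
2. & 4. `ρ̄` and `r` absolutely irreducible — the sibling's lattice bridge
   `isAbsIrreducible_of_isResidualRepOf_of_restrictField_numberField` (Brauer–Nesbitt);
3. `ρ̄` decomposed generic — the sibling's `isDecomposedGeneric_of_projectiveImage_ne_bot`
   (Caraiani–Newton 6.2.2): the projective image of `r` is finite (`ker ρ̄` is open), of order
   prime to `p` (hypothesis), and non-trivial — indeed not even cyclic, by absolute irreducibility
   (`not_isIrreducible_of_isCyclicType`);
5. `ρ̄(Γ_{F(ζ_p)}) = r(Γ_{F(ζ_p)})` enormous — helper `isEnormous_range_of_not_dvd_card` (file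
   `…StubQianPackageOfPrimeToPEnormous`: EVERY absolutely irreducible prime-to-`p` finite subgroup
   of `GL₂(𝔽̄_p)`, `p ≠ 2`, is enormous; this covers the dihedral corner landed by the sibling and
   the primitive types `𝔄₄`, `𝔖₄`, `𝔄₅` of Serre 1972 Prop. 16 at once); `|r(Γ_{F(ζ_p)})|` is
   prime to `p` because its projective image is and the scalars of `𝔽̄_p = ℤ̄_p/𝔪` have finite
   prime-to-`p` order (`not_dvd_card_range_of_not_dvd_card_projectiveImage`,
   `exists_pow_eq_one_padicAlgClResidueField`);
6. a scalar `ρ̄(σ)` with `σ ∉ Γ_{F(ζ_p)}` — helper `exists_not_mem_scalar_of_not_isCyclic` (file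
   `…StubQianPackageOfPrimeToPScalar`: `[F : ℚ] = 2`, `p ≥ 11`, Serre 1972 Prop. 16 on
   `Proj ρ̄(Γ_F)`; ACC+ Rem. 6.1.4).

The hypotheses "`F` totally complex" and "`p` split in `F`" of the registered signature are not
used.

## References

* [Qian2022] L. Qian, *Potential automorphy for `GL_n`*, Invent. Math. 231 (2023), Thm. 1.4.
* [ACCGHLNSTT2023] P. B. Allen et al., *Potential automorphy over CM fields*, Ann. of Math. 197
  (2023), Def. 4.3.1, Def. 6.2.28, Rem. 6.1.4.
* [CaraianiNewton2023] A. Caraiani, J. Newton, arXiv:2301.10509v3, Lemma 6.2.2.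
* [Serre1972] J.-P. Serre, Invent. Math. 15 (1972), §2.5, Prop. 16.
* [DarmonDiamondTaylor1995] H. Darmon, F. Diamond, R. Taylor, *Fermat's Last Theorem* (1995), §2.1.
-/

set_option linter.dupNamespace false

noncomputable section

namespace Summit.Langlands.Langlands.Cruxes.LocallyReducibleParallel.Potaut

open scoped NumberField MatrixGroups
open IsDedekindDomain Field NumberField Filter Literature.NumberTheory.GaloisRepresentations
  Literature.NumberTheory.PAdicHodge Literature.NumberTheory.Automorphic
open Summit.Langlands.Langlands.Theorems.TensorSquareParallel
open Summit.Langlands.Langlands.Cruxes.AdjointLiftingGL3.Birth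

/-! ## The order of the image from the order of the projective image -/
section Card

/-- **`p ∤ |proj. image| ⟹ p ∤ |image|`** for a finite image in `GL₂(k)` when the units of `k`
have finite order prime to `p` (e.g. `k = 𝔽̄_p`): an element of order `p` of the image (Cauchy)
would die in the projective image, hence be a scalar `u · 1` with `u` of order `p`. [folklore] -/
theorem not_dvd_card_range_of_not_dvd_card_projectiveImage {k : Type*} [Field k] {p : ℕ}
    [Fact p.Prime] (htor : ∀ a : kˣ, ∃ m : ℕ, ¬ p ∣ m ∧ a ^ m = 1) {G : Type*} [Group G]
    (r : G →* GL (Fin 2) k) [Finite r.range]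
    (hcop : ¬ p ∣ Nat.card (projectiveImage r)) : ¬ p ∣ Nat.card r.range := by
  intro hdvd
  obtain ⟨x, hx⟩ := exists_prime_orderOf_dvd_card' (G := r.range) p hdvd
  haveI : Finite (projectiveImage r) := finite_projectiveImage_of_finite_range r
  set y := rangeToProjectiveImage r x with hy
  have hyp : orderOf y ∣ p := by rw [← hx]; exact orderOf_map_dvd _ x
  have hy1 : orderOf y = 1 := by
    rcases (Nat.dvd_prime Fact.out).1 hyp with h | h
    · exact h
    · exact absurd (h ▸ orderOf_dvd_natCard y) hcop
  -- so `x` is a scalar `u · 1`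
  have hxker : x ∈ (rangeToProjectiveImage r).ker := by
    rw [MonoidHom.mem_ker, ← orderOf_eq_one_iff, hy1]
  have hxc := mem_center_of_mem_ker_rangeToProjectiveImage r hxker
  rw [Matrix.GeneralLinearGroup.center_eq_range_scalar] at hxc
  obtain ⟨u, hu⟩ := hxc
  obtain ⟨m, hm, hum⟩ := htor u
  have h1 : orderOf (x : GL (Fin 2) k) ∣ m := by
    rw [← hu]
    exact orderOf_dvd_of_pow_eq_one (by rw [← map_pow, hum, map_one])
  rw [Subgroup.orderOf_coe, hx] at h1
  exact hm h1

end Card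

/-! ## The package -/
section Package

/-- **Stub `stub_qianPackage_of_primeToP` (registered signature verbatim) — the residual image
package of Qian 2023, Thm. 1.4 (iii)–(iv) for `ρ̄ = ρ.residualRep`, `ρ : Γ_F → GL₂(ℚ̄_p)`, `F`
imaginary quadratic, `p ≥ 11`, when `ρ|_{Γ_{F(ζ_p)}}` is residually absolutely irreducible and the
PROJECTIVE image of `r = ρ̄|_{Γ_{F(ζ_p)}}` has order prime to `p`** (the dihedral ∪ `𝔄₄` ∪ `𝔖₄` ∪
`𝔄₅` corner of Serre 1972 Prop. 16): (i) `ρ̄` is a residual representation of `ρ` (rank two,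
tree `isResidualRepOf_residualRep_fin_two`); (ii) & (iv) `ρ̄` and `r` absolutely irreducible (the
sibling's lattice bridge `isAbsIrreducible_of_isResidualRepOf_of_restrictField_numberField`);
(iii) decomposed generic (sibling's `isDecomposedGeneric_of_projectiveImage_ne_bot`: the projective
image is finite — `ker ρ̄` is open —, non-trivial — not even cyclic, by absolute irreducibility and
`not_isIrreducible_of_isCyclicType` — and of order prime to `p`); (v) `ρ̄(Γ_{F(ζ_p)}) = r(Γ_{F(ζ_p)})`
enormous (`isEnormous_range_of_not_dvd_card`; `|r(Γ_{F(ζ_p)})|` is prime to `p` by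
`not_dvd_card_range_of_not_dvd_card_projectiveImage`, the units of `𝔽̄_p = ℤ̄_p/𝔪` having finite
prime-to-`p` order, `exists_pow_eq_one_padicAlgClResidueField`); (vi) a scalar `ρ̄(σ)`,
`σ ∉ Γ_{F(ζ_p)}` (`exists_not_mem_scalar_of_not_isCyclic`, `[F : ℚ] = 2`, `p ≥ 11`).  The
hypotheses "`F` totally complex" and "`p` split in `F`" are not used.
[cite: Qian2022, Thm. 1.4 (hypotheses (iii)–(iv))] -/
theorem stub_qianPackage_of_primeToP : ∀ (F : Type) [Field F] [NumberField F] [Algebra.IsQuadraticExtension ℚ F], NumberField.IsTotallyComplex F → ∀ (p : ℕ) [Fact p.Prime] (ρ : FramedGaloisRep F (PadicAlgCl p) 2), 11 ≤ p → (∃ v w : HeightOneSpectrum (𝓞 F), v ≠ w ∧ ((p : ℕ) : 𝓞 F) ∈ v.asIdeal ∧ ((p : ℕ) : 𝓞 F) ∈ w.asIdeal) → FramedGaloisRep.IsResiduallyAbsIrreducible (ρ.restrictField (CyclotomicField p F)) → ¬ p ∣ Nat.card (projectiveImage (ρ.residualRep.comp (absGaloisGroupAdjoinRootsOfUnity F p).subtype))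 → (ρ.IsResidualRepOf (RingHom.id _) ρ.residualRep ∧ IsAbsIrreducible ρ.residualRep ∧ IsDecomposedGeneric ρ.residualRep ∧ IsAbsIrreducible (ρ.residualRep.comp (absGaloisGroupAdjoinRootsOfUnity F p).subtype) ∧ Subgroup.IsEnormous ((absGaloisGroupAdjoinRootsOfUnity F p).map ρ.residualRep) ∧ ∃ σ : absoluteGaloisGroup F, σ ∉ absGaloisGroupAdjoinRootsOfUnity F p ∧ ∃ c : padicAlgClResidueField p, ((ρ.residualRep σ : GL (Fin 2) (padicAlgClResidueField p)) : Matrix (Fin 2) (Fin 2) (padicAlgClResidueField p)) = c • (1 : Matrix (Fin 2) (Fin 2) (padicAlgClResidueField p))) := by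
  intro F _ _ _ _ p _ ρ hp _ hirr hPcop
  have hp2 : p ≠ 2 := by omega
  have hF2 : Module.finrank ℚ F = 2 := Algebra.IsQuadraticExtension.finrank_eq_two ℚ F
  haveI : CharP (padicAlgClResidueField p) p := charP_padicAlgClResidueField p
  haveI : IsAlgClosed (padicAlgClResidueField p) :=
    Literature.RingTheory.Valuation.isAlgClosed_residueField (padicAlgClIntegers p)
  have htor := exists_pow_eq_one_padicAlgClResidueField p
  set Γ₁ := absGaloisGroupAdjoinRootsOfUnity F p with hΓ₁
  set τ := ρ.residualRep with hτdef
  set r := τ.comp Γ₁.subtype with hr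
  -- (i) `ρ̄` is a residual representation of `ρ` (rank two)
  have hres : ρ.IsResidualRepOf (RingHom.id _) τ := ρ.isResidualRepOf_residualRep_fin_two
  -- (ii), (iv) absolute irreducibility of `ρ̄` and of `r`
  obtain ⟨habs₁, habs⟩ :=
    isAbsIrreducible_of_isResidualRepOf_of_restrictField_numberField ρ hirr hres
  -- the image of `ρ̄` is finite (`ker ρ̄` is open), hence so are `r(Γ₁)` and its projective image
  haveI : Finite τ.range := FramedGaloisRep.finite_range_of_isResidualRepOf hres
  haveI : Finite r.range := by
    have hle : r.range ≤ τ.range := by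
      rw [hr, MonoidHom.range_comp]; exact Subgroup.map_le_range _ _
    exact Finite.of_injective _ (Subgroup.inclusion_injective hle)
  haveI : Finite (projectiveImage r) := finite_projectiveImage_of_finite_range r
  have hcop : ¬ p ∣ Nat.card r.range :=
    not_dvd_card_range_of_not_dvd_card_projectiveImage htor r hPcop
  -- (v) enormous image on `Γ_{F(ζ_p)}`
  have hrange : Γ₁.map τ = r.range := by
    rw [hr, MonoidHom.range_comp, Subgroup.range_subtype]
  have hen : Subgroup.IsEnormous (Γ₁.map τ) := by
    rw [hrange]
    exact isEnormous_range_of_not_dvd_card hp2 htor r hcop habs₁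
  -- the projective image of `r` is not cyclic (absolute irreducibility), so non-trivial
  have hnc : ¬ IsCyclic (projectiveImage r) := fun hc ↦
    not_isIrreducible_of_isCyclicType r hc habs₁.isIrreducible
  have hPne : projectiveImage r ≠ ⊥ := by
    intro hbot
    apply hnc
    rw [hbot]
    infer_instance
  -- (iii) decomposed generic (Caraiani–Newton 6.2.2)
  have hdg : IsDecomposedGeneric τ :=
    isDecomposedGeneric_of_projectiveImage_ne_bot F hF2 hp2 τ
      (FramedGaloisRep.isOpen_ker_of_isResidualRepOf hres) hPne hPcop
  -- (vi) the scalar element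
  exact ⟨hres, habs, hdg, habs₁, hen, exists_not_mem_scalar_of_not_isCyclic p F hF2 hp τ hPcop hnc⟩

end Package

end Summit.Langlands.Langlands.Cruxes.LocallyReducibleParallel.Potaut

end
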